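import Mathlib.RingTheory.DiscreteValuationRing.TFAE
import Mathlib.RingTheory.AdjoinRoot
import Mathlib.RingTheory.Nakayama
import Mathlib.RingTheory.Ideal.GoingUp
import Literature.AlgebraicGeometry.Resolution.RegularCentreRsopPart
import HarnessLib

/-!
# [OURS · L1 W4.2] CURVE GERMS IN A CP FRAME ARE FRAME-ADAPTED — the pure algebra of W4.2 D18 (ii) (Q1):
# `R ↠ R[X]/𝔭` and `𝔭 = (X − θ, v₁, …, v_n)` for every regular curve germ `V(𝔭) ⊆ V(h)` through the origin of a frame `(R, u, h)`
# (cell res-hironaka, LADDER-RESOLUTION rung L; slot W4.2, crux chain w42 `SigmaMaxModificationsCorridor3`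
# stmt-ResolutionOfSingularities-19249; `--supports stmt-ResolutionOfSingularities-19249 --as helper`; res-L1-w42-plan-1 RULING
# v3.14-12a (BR-11) 10:24:54Z «D18 (ii) SPLIT … GO NOW as a ring-level file»; hand res-D-brk-3 (gen 5); D18 holder res-D-pv-050)

PURE COMMUTATIVE ALGEBRA, binder-free, no scheme, no `IsCPFrame`/`IsHypStage` plumbing (that is res-D-pv-050's (P2)/(ii); this is the
ring-level core split off by RULING (BR-11)). OURS bookkeeping; NOT a statement of Hironaka's manuscript [Hironaka2017] nor of
[CossartJannsenSaito2020] / [CossartPiltant2019]; 0 `def`s, every declaration PROVED. AI-written, weaker than expert review. Plan-1's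
requested extra hypotheses `IsAdicComplete` and `C h ∈ 𝔭 ^ m` are NOT needed (res-D-brk-3 ADDENDUM 10:24:23Z) and do not appear.

SETTING: `R` Noetherian local (`𝔪`), `h ∈ R[X]` MONIC of degree `m ≥ 1` with `coeff_i h ∈ 𝔪^{m−i}` for `i < m` (the «δ(Δ) ≥ 1» shape of a
Cossart–Piltant frame polynomial), `𝔭 ⊂ R[X]` a prime containing `h` with `R[X]/𝔭` a DVR (= regular of dimension `1`, tree bridge
`Resolution.isDiscreteValuationRing_of_isRegularLocalRing_of_ringKrullDim_eq_one`) — a regular CURVE GERM inside `V(h)`.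
* §1/§3: the frame origin `𝔑 = (𝔪, X)` (kernel of `p ↦ p(0) mod 𝔪`, maximal) and `le_frameOrigin_of_mem`: every proper ideal containing
  `h` lies in `𝔑` (`R[X]/(h)` is finite over `R`; `X^m ≡ h mod 𝔪R[X]`) — i.e. `R[X]/(h)` is local, as `IsCPFrame` demands.
* §2 `surjective_algebraMap_quotient_of_frame`: **`R ↠ R[X]/𝔭`** — with `x = X̄`, `I = 𝔪·(R[X]/𝔭)`, `𝔪_D = I + (x)`: if `x ∉ I` then
  `I ⊆ 𝔪_D²` (ideals of a DVR are powers of `𝔪_D`), `𝔪_D = (x)` (Nakayama), `h_i ↦ (x^{2(m−i)})`, and `h(x) = 0` gives `x^m ∈ (x^{m+1})`,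
  `x = 0` — absurd; so `𝔪_D = I` and Nakayama on the finite `R`-module `R[X]/𝔭` concludes. (Geometrically: the germ is transversal to `∂_X`.)
* §4 `exists_X_sub_C_mem_of_frame` (`X ≡ θ`, `θ ∈ 𝔪`); **`exists_isRsopPart_span_eq_of_frame`**: for `R` REGULAR of dimension `n + 1`,
  `𝔭 = (X − θ, v₁, …, v_n)` with `v` PART OF A REGULAR SYSTEM OF PARAMETERS (`R/(𝔭 ∩ R) ≅ R[X]/𝔭` is a DVR ⇒ `𝔭 ∩ R = (v)` by the tree's
  `exists_isRsopPart_fin_span_range_eq`, Matsumura 14.2); **`exists_isRsopPart_map_span_eq_of_frame`**: the same on the frame carrier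
  `R[X] ⧸ (h)` of res-type-067's `IsCPFrame`/`IsCPFrameAlong` — the shape `Ideal.map (Ideal.Quotient.mk (Ideal.span {h})) (Ideal.span {…})`,
  up to `X ↦ X − θ` (res-D-pv-050 `isCPFrame_translate`, p521363) and `u ↦ (u₀', v)`; polyhedron MINIMALITY (Q2)/hVP stays with 050.

Consumer: res-D-pv-050's `exists_isCPFrameAlong_of_isHypStage` (D18 (ii)); with p522469 this is the algebraic half of the CURVE case of
`CycleEndCentreDichotomy3`. References: Matsumura, *Commutative Ring Theory*, Thm. 9.3, 11.2, 14.2 [Matsumura1987]; Cossart–Piltant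
arXiv:1412.0868 Def. 2.2–2.4 (context) [CossartPiltant2019]; HOME STATUS res-L1-w42-plan-1 10:24:54Z (BR-11), res-D-pv-050 09:33:13Z.
-/

noncomputable section

set_option linter.dupNamespace false

open IsLocalRing Polynomial

universe u

namespace Summit.ResolutionOfSingularities.ResolutionOfSingularities.Theorems.SigmaMaxModificationsCorridor3.Helpers

variable {R : Type u} [CommRing R]

section Local

variable [IsLocalRing R]

/-! ## §1. The frame origin `𝔑 = (𝔪_R, X) ⊂ R[X]` -/

/-- The ideal `(𝔪_R, X)` of `R[X]` is the kernel of `p ↦ p(0) mod 𝔪_R`. [folklore] -/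
theorem map_maximalIdeal_sup_span_X_eq_ker :
    (maximalIdeal R).map (C : R →+* R[X]) ⊔ Ideal.span {X} =
      RingHom.ker ((residue R).comp (evalRingHom 0)) := by
  apply le_antisymm
  · refine sup_le ?_ ?_
    · rw [Ideal.map_le_iff_le_comap]
      intro a ha
      rw [Ideal.mem_comap, RingHom.mem_ker, RingHom.comp_apply, coe_evalRingHom, eval_C, residue_eq_zero_iff]
      exact ha
    · rw [Ideal.span_le, Set.singleton_subset_iff, SetLike.mem_coe, RingHom.mem_ker, RingHom.comp_apply,
        coe_evalRingHom, eval_X, map_zero]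
  · intro p hp
    rw [RingHom.mem_ker, RingHom.comp_apply, coe_evalRingHom, residue_eq_zero_iff] at hp
    have hsplit : p = C (p.coeff 0) + (p - C (p.coeff 0)) := by ring
    rw [hsplit]
    refine Ideal.add_mem _ (Ideal.mem_sup_left (Ideal.mem_map_of_mem _ ?_)) (Ideal.mem_sup_right ?_)
    · rwa [coeff_zero_eq_eval_zero]
    · exact Ideal.mem_span_singleton.mpr X_dvd_sub_C

/-- `(𝔪_R, X)` is a maximal ideal of `R[X]` (its quotient is the residue field of `R`). [folklore] -/
theorem isMaximal_map_maximalIdeal_sup_span_X :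
    ((maximalIdeal R).map (C : R →+* R[X]) ⊔ Ideal.span {X}).IsMaximal := by
  rw [map_maximalIdeal_sup_span_X_eq_ker]
  refine RingHom.ker_isMaximal_of_surjective _ fun a => ?_
  obtain ⟨r, rfl⟩ := residue_surjective a
  exact ⟨C r, by simp⟩


/-! ## §2. `R ↠ R[X]/𝔭` for a regular curve germ `V(𝔭) ⊆ V(h)` through the origin of a `δ ≥ 1` frame -/

/-- [OURS · L1 W4.2] **`R ↠ R[X]/𝔭` — a regular curve germ inside a `δ ≥ 1` hypersurface frame is the graph of a section.** `R` Noetherian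
local, `h` monic of degree `m ≥ 1` with `coeff_i h ∈ 𝔪^{m−i}` (`i < m`), `𝔭 ∋ h` a prime inside the frame origin `(𝔪, X)` with `R[X]/𝔭` a DVR:
then `R → R[X]/𝔭` is SURJECTIVE (proof in the module docstring). [cite: Matsumura1987, Thm. 11.2] -/
theorem surjective_algebraMap_quotient_of_frame [IsNoetherianRing R] {h : R[X]} (hmo : h.Monic)
    (hm : 0 < h.natDegree) (hco : ∀ i < h.natDegree, h.coeff i ∈ maximalIdeal R ^ (h.natDegree - i))
    {𝔭 : Ideal R[X]} [𝔭.IsPrime] (hh : h ∈ 𝔭)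
    (h𝔭 : 𝔭 ≤ (maximalIdeal R).map (C : R →+* R[X]) ⊔ Ideal.span {X})
    [IsDiscreteValuationRing (R[X] ⧸ 𝔭)] :
    Function.Surjective (algebraMap R (R[X] ⧸ 𝔭)) := by
  classical
  have halg : algebraMap R (R[X] ⧸ 𝔭) = (Ideal.Quotient.mk 𝔭).comp C := RingHom.ext fun _ => rfl
  set x : R[X] ⧸ 𝔭 := Ideal.Quotient.mk 𝔭 X with hxdef
  set I : Ideal (R[X] ⧸ 𝔭) := (maximalIdeal R).map (algebraMap R (R[X] ⧸ 𝔭)) with hIdef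
  haveI hfin : Module.Finite R (R[X] ⧸ 𝔭) := by
    haveI : Module.Finite R (R[X] ⧸ Ideal.span {h}) := hmo.finite_adjoinRoot
    have hle : Ideal.span {h} ≤ 𝔭 := (Ideal.span_singleton_le_iff_mem _).mpr hh
    refine Module.Finite.of_surjective (Ideal.Quotient.factorₐ R hle).toLinearMap fun d => ?_
    obtain ⟨p, rfl⟩ := Ideal.Quotient.mk_surjective d
    exact ⟨Ideal.Quotient.mk _ p, rfl⟩
  have hmD : maximalIdeal (R[X] ⧸ 𝔭) = I ⊔ Ideal.span {x} := by
    have hmap : ((maximalIdeal R).map (C : R →+* R[X]) ⊔ Ideal.span {X}).map (Ideal.Quotient.mk 𝔭) =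
        I ⊔ Ideal.span {x} := by
      rw [Ideal.map_sup, Ideal.map_map, ← halg, Ideal.map_span, Set.image_singleton]
    rw [← hmap]
    symm
    apply IsLocalRing.eq_maximalIdeal
    rcases Ideal.map_eq_top_or_isMaximal_of_surjective (Ideal.Quotient.mk 𝔭) Ideal.Quotient.mk_surjective
      (isMaximal_map_maximalIdeal_sup_span_X (R := R)) with htop | hmax
    · exfalso
      have := congrArg (Ideal.comap (Ideal.Quotient.mk 𝔭)) htop
      rw [Ideal.comap_map_of_surjective _ Ideal.Quotient.mk_surjective, Ideal.comap_top, ← RingHom.ker_eq_comap_bot,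
        Ideal.mk_ker, sup_eq_left.mpr h𝔭] at this
      exact (isMaximal_map_maximalIdeal_sup_span_X (R := R)).ne_top this
    · exact hmax
  have hx𝔪 : x ∈ maximalIdeal (R[X] ⧸ 𝔭) := hmD ▸ Ideal.mem_sup_right (Ideal.mem_span_singleton_self x)
  have hI𝔪 : I ≤ maximalIdeal (R[X] ⧸ 𝔭) := hmD ▸ le_sup_left
  have key : x ∈ I := by
    by_contra hxI
    have hI2 : I ≤ maximalIdeal (R[X] ⧸ 𝔭) ^ 2 := by
      obtain ⟨ϖ, hϖ⟩ := IsDiscreteValuationRing.exists_irreducible (R[X] ⧸ 𝔭)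
      have h𝔪ϖ : maximalIdeal (R[X] ⧸ 𝔭) = Ideal.span {ϖ} := hϖ.maximalIdeal_eq
      by_cases hI0 : I = ⊥
      · rw [hI0]; exact bot_le
      obtain ⟨e, he⟩ := IsDiscreteValuationRing.ideal_eq_span_pow_irreducible hI0 hϖ
      have he2 : 2 ≤ e := by
        by_contra hlt
        have hlt' : e < 2 := not_le.mp hlt
        interval_cases e
        · rw [pow_zero, Ideal.span_singleton_one] at he
          exact hxI (he ▸ Submodule.mem_top)
        · rw [pow_one, ← h𝔪ϖ] at he
          exact hxI (he ▸ hx𝔪)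
      rw [he, h𝔪ϖ, Ideal.span_singleton_pow]
      exact Ideal.span_singleton_le_span_singleton.mpr (pow_dvd_pow ϖ he2)
    have h𝔪x : maximalIdeal (R[X] ⧸ 𝔭) = Ideal.span {x} := by
      refine le_antisymm ?_ ((Ideal.span_singleton_le_iff_mem _).mpr hx𝔪)
      refine Submodule.le_of_le_smul_of_le_jacobson_bot (IsNoetherian.noetherian _)
        (maximalIdeal_le_jacobson ⊥) ?_
      calc maximalIdeal (R[X] ⧸ 𝔭) = I ⊔ Ideal.span {x} := hmD
        _ ≤ maximalIdeal (R[X] ⧸ 𝔭) ^ 2 ⊔ Ideal.span {x} := sup_le_sup_right hI2 _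
        _ = Ideal.span {x} ⊔ maximalIdeal (R[X] ⧸ 𝔭) • maximalIdeal (R[X] ⧸ 𝔭) := by
          rw [sup_comm, sq, smul_eq_mul]
    have hterm : ∀ i < h.natDegree,
        algebraMap R (R[X] ⧸ 𝔭) (h.coeff i) * x ^ i ∈ Ideal.span {x ^ (h.natDegree + 1)} := by
      intro i hi
      have h1 : algebraMap R (R[X] ⧸ 𝔭) (h.coeff i) ∈ Ideal.span {x ^ (2 * (h.natDegree - i))} := by
        have : algebraMap R (R[X] ⧸ 𝔭) (h.coeff i) ∈ I ^ (h.natDegree - i) := by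
          rw [hIdef, ← Ideal.map_pow]
          exact Ideal.mem_map_of_mem _ (hco i hi)
        have hle : I ^ (h.natDegree - i) ≤ Ideal.span {x ^ (2 * (h.natDegree - i))} := by
          calc I ^ (h.natDegree - i) ≤ (maximalIdeal (R[X] ⧸ 𝔭) ^ 2) ^ (h.natDegree - i) := Ideal.pow_right_mono hI2 _
            _ = Ideal.span {x ^ (2 * (h.natDegree - i))} := by rw [← pow_mul, h𝔪x, Ideal.span_singleton_pow]
        exact hle this
      obtain ⟨a, ha⟩ := Ideal.mem_span_singleton'.mp h1
      have hexp : 2 * (h.natDegree - i) + i = (h.natDegree - i - 1) + (h.natDegree + 1) := by omega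
      have hrw : a * x ^ (2 * (h.natDegree - i)) * x ^ i = a * x ^ (h.natDegree - i - 1) * x ^ (h.natDegree + 1) := by
        rw [mul_assoc, mul_assoc, ← pow_add, ← pow_add, hexp]
      rw [← ha, hrw]
      exact Ideal.mul_mem_left _ _ (Ideal.mem_span_singleton_self _)
    have hxm : x ^ h.natDegree ∈ Ideal.span {x ^ (h.natDegree + 1)} := by
      have h0 : Ideal.Quotient.mk 𝔭 h = 0 := Ideal.Quotient.eq_zero_iff_mem.mpr hh
      rw [hmo.as_sum, map_add, map_pow, map_sum] at h0
      have hsum : ∑ i ∈ Finset.range h.natDegree, Ideal.Quotient.mk 𝔭 (C (h.coeff i) * X ^ i) ∈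
          Ideal.span {x ^ (h.natDegree + 1)} := by
        refine Ideal.sum_mem _ fun i hi => ?_
        rw [map_mul, map_pow, ← hxdef, ← RingHom.comp_apply, ← halg]
        exact hterm i (Finset.mem_range.mp hi)
      have : x ^ h.natDegree = -∑ i ∈ Finset.range h.natDegree, Ideal.Quotient.mk 𝔭 (C (h.coeff i) * X ^ i) :=
        eq_neg_of_add_eq_zero_left h0
      rw [this]
      exact Submodule.neg_mem _ hsum
    obtain ⟨c, hc⟩ := Ideal.mem_span_singleton'.mp hxm
    have hzero : x ^ h.natDegree * (1 - c * x) = 0 := by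
      have : x ^ h.natDegree * (1 - c * x) = x ^ h.natDegree - c * x ^ (h.natDegree + 1) := by ring
      rw [this, hc, sub_self]
    have hunit : IsUnit (1 - c * x) :=
      IsLocalRing.isUnit_one_sub_self_of_mem_nonunits _ (Ideal.mul_mem_left _ c hx𝔪)
    have hx0 : x = 0 := (pow_eq_zero_iff hm.ne').mp ((hunit.mul_left_eq_zero).mp hzero)
    have hbot : maximalIdeal (R[X] ⧸ 𝔭) = ⊥ := by rw [h𝔪x, hx0, Ideal.span_singleton_eq_bot]
    exact IsDiscreteValuationRing.not_a_field' (R := R[X] ⧸ 𝔭) hbot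
  have htop : (⊤ : Submodule R (R[X] ⧸ 𝔭)) ≤
      LinearMap.range (Algebra.linearMap R (R[X] ⧸ 𝔭)) ⊔ (maximalIdeal R) • ⊤ := by
    rintro d -
    obtain ⟨p, rfl⟩ := Ideal.Quotient.mk_surjective d
    induction p using Polynomial.induction_on with
    | C a => exact Submodule.mem_sup_left ⟨a, by rw [Algebra.linearMap_apply, halg]; rfl⟩
    | add p q hp hq => rw [map_add]; exact Submodule.add_mem _ hp hq
    | monomial n a _ =>
      refine Submodule.mem_sup_right ?_
      rw [Ideal.smul_top_eq_map, Submodule.restrictScalars_mem, ← hIdef, map_mul, map_pow, ← hxdef,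
        ← RingHom.comp_apply, ← halg]
      exact Ideal.mul_mem_left _ _ (Ideal.pow_mem_of_mem I key _ n.succ_pos)
  have hN := Submodule.le_of_le_smul_of_le_jacobson_bot Module.Finite.fg_top (maximalIdeal_le_jacobson ⊥) htop
  intro d
  obtain ⟨r, hr⟩ := hN (Submodule.mem_top : d ∈ ⊤)
  exact ⟨r, hr⟩


/-! ## §3. Every prime containing the frame polynomial lies in the frame origin -/

/-- [OURS · L1 W4.2] **Every proper ideal of `R[X]` containing the frame polynomial lies in the frame origin `(𝔪, X)`** (`R` local, `h`
monic with `coeff_i h ∈ 𝔪^{m−i}`): a maximal `𝔐 ∋ h` contracts to `𝔪` (integrality of `R[X]/(h)`), so `X^m = h − Σ h_i X^i ∈ 𝔐`, `X ∈ 𝔐`.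
(So `R[X]/(h)` is local — the `IsLocalRing` clause of res-type-067's `IsCPFrame`.) [cite: Matsumura1987, Thm. 9.3] -/
theorem le_frameOrigin_of_mem {h : R[X]} (hmo : h.Monic)
    (hco : ∀ i < h.natDegree, h.coeff i ∈ maximalIdeal R ^ (h.natDegree - i))
    {𝔭 : Ideal R[X]} (hne : 𝔭 ≠ ⊤) (hh : h ∈ 𝔭) :
    𝔭 ≤ (maximalIdeal R).map (C : R →+* R[X]) ⊔ Ideal.span {X} := by
  classical
  obtain ⟨𝔐, h𝔐, hle⟩ := Ideal.exists_le_maximal 𝔭 hne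
  have hh𝔐 : h ∈ 𝔐 := hle hh
  have hcomap : 𝔐.comap (C : R →+* R[X]) = maximalIdeal R := by
    haveI : Module.Finite R (R[X] ⧸ Ideal.span {h}) := hmo.finite_adjoinRoot
    have hker : Ideal.span {h} ≤ 𝔐 := (Ideal.span_singleton_le_iff_mem _).mpr hh𝔐
    have h𝔐' : (𝔐.map (Ideal.Quotient.mk (Ideal.span {h}))).IsMaximal := by
      rcases Ideal.map_eq_top_or_isMaximal_of_surjective (Ideal.Quotient.mk (Ideal.span {h}))
        Ideal.Quotient.mk_surjective h𝔐 with htop | hmax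
      · exfalso
        have := congrArg (Ideal.comap (Ideal.Quotient.mk (Ideal.span {h}))) htop
        rw [Ideal.comap_map_of_surjective _ Ideal.Quotient.mk_surjective, Ideal.comap_top, ← RingHom.ker_eq_comap_bot,
          Ideal.mk_ker, sup_eq_left.mpr hker] at this
        exact h𝔐.ne_top this
      · exact hmax
    haveI := h𝔐'
    have hint := Ideal.isMaximal_comap_of_isIntegral_of_isMaximal (R := R) (S := R[X] ⧸ Ideal.span {h})
      (𝔐.map (Ideal.Quotient.mk (Ideal.span {h})))
    have halg : algebraMap R (R[X] ⧸ Ideal.span {h}) = (Ideal.Quotient.mk (Ideal.span {h})).comp C :=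
      RingHom.ext fun _ => rfl
    rw [halg, ← Ideal.comap_comap, Ideal.comap_map_of_surjective _ Ideal.Quotient.mk_surjective,
      ← RingHom.ker_eq_comap_bot, Ideal.mk_ker, sup_eq_left.mpr hker] at hint
    exact IsLocalRing.eq_maximalIdeal hint
  have hmap𝔐 : (maximalIdeal R).map (C : R →+* R[X]) ≤ 𝔐 := by
    rw [Ideal.map_le_iff_le_comap, hcomap]
  have hXm : X ^ h.natDegree ∈ 𝔐 := by
    have hsum : ∑ i ∈ Finset.range h.natDegree, C (h.coeff i) * X ^ i ∈ 𝔐 := by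
      refine Ideal.sum_mem _ fun i hi => Ideal.mul_mem_right _ _ (hmap𝔐 (Ideal.mem_map_of_mem _ ?_))
      have hi' := Finset.mem_range.mp hi
      exact Ideal.pow_le_self (by omega) (hco i hi')
    have : X ^ h.natDegree = h - ∑ i ∈ Finset.range h.natDegree, C (h.coeff i) * X ^ i := by
      rw [eq_sub_iff_add_eq]
      exact hmo.as_sum.symm
    rw [this]
    exact Ideal.sub_mem _ hh𝔐 hsum
  have hX : (X : R[X]) ∈ 𝔐 := h𝔐.isPrime.mem_of_pow_mem _ hXm
  have hN𝔐 : (maximalIdeal R).map (C : R →+* R[X]) ⊔ Ideal.span {X} ≤ 𝔐 :=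
    sup_le hmap𝔐 ((Ideal.span_singleton_le_iff_mem _).mpr hX)
  rw [(isMaximal_map_maximalIdeal_sup_span_X (R := R)).eq_of_le h𝔐.ne_top hN𝔐]
  exact hle

/-! ## §4. The adapted presentation `𝔭 = (X − θ, v₁, …, v_n)` -/

/-- [OURS · L1 W4.2] **`X ≡ θ (mod 𝔭)` for some `θ ∈ 𝔪`** (hypotheses of `surjective_algebraMap_quotient_of_frame`, the origin clause
supplied by `le_frameOrigin_of_mem`): `θ` is a preimage of `X̄`; it is a non-unit because `X̄` lies in the proper ideal `(𝔪, X̄)`.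
[folklore] -/
theorem exists_X_sub_C_mem_of_frame [IsNoetherianRing R] {h : R[X]} (hmo : h.Monic) (hm : 0 < h.natDegree)
    (hco : ∀ i < h.natDegree, h.coeff i ∈ maximalIdeal R ^ (h.natDegree - i))
    {𝔭 : Ideal R[X]} [𝔭.IsPrime] (hh : h ∈ 𝔭) [IsDiscreteValuationRing (R[X] ⧸ 𝔭)] :
    ∃ θ ∈ maximalIdeal R, X - C θ ∈ 𝔭 := by
  have h𝔭 := le_frameOrigin_of_mem hmo hco (Ideal.IsPrime.ne_top inferInstance) hh
  obtain ⟨θ, hθ⟩ := surjective_algebraMap_quotient_of_frame hmo hm hco hh h𝔭 (Ideal.Quotient.mk 𝔭 X)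
  have hmem : X - C θ ∈ 𝔭 := by
    rw [← Ideal.Quotient.eq, ← hθ]
    rfl
  refine ⟨θ, ?_, hmem⟩
  by_contra hθm
  have hθu : IsUnit θ := by
    by_contra hnu
    exact hθm ((IsLocalRing.mem_maximalIdeal θ).mpr hnu)
  have hXu : IsUnit (Ideal.Quotient.mk 𝔭 X) := by
    rw [← hθ]
    exact hθu.map _
  have hNtop : ((maximalIdeal R).map (C : R →+* R[X]) ⊔ Ideal.span {X}).map (Ideal.Quotient.mk 𝔭) ≠ ⊤ := by
    intro htop
    have := congrArg (Ideal.comap (Ideal.Quotient.mk 𝔭)) htop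
    rw [Ideal.comap_map_of_surjective _ Ideal.Quotient.mk_surjective, Ideal.comap_top, ← RingHom.ker_eq_comap_bot,
      Ideal.mk_ker, sup_eq_left.mpr h𝔭] at this
    exact (isMaximal_map_maximalIdeal_sup_span_X (R := R)).ne_top this
  refine hNtop (Ideal.eq_top_of_isUnit_mem _ ?_ hXu)
  exact Ideal.mem_map_of_mem _ (Ideal.mem_sup_right (Ideal.mem_span_singleton_self X))

end Local

section Regular

variable [IsRegularLocalRing R]

/-- [OURS · L1 W4.2] **CURVE GERMS IN A CP FRAME ARE FRAME-ADAPTED** (W4.2 D18 (ii)/(Q1), plan-1 RULING v3.14-12a (BR-11)): `R` REGULAR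
local of dimension `n + 1`, `h` monic of degree `m ≥ 1` with `coeff_i h ∈ 𝔪^{m−i}`, `𝔭 ∋ h` a prime with `R[X]/𝔭` a DVR ⇒ `𝔭 = (X − θ, v₁, …, v_n)`
with `θ ∈ 𝔪` and `v` part of a regular system of parameters of `R` (`R/(𝔭 ∩ R) ≅ R[X]/𝔭` is a DVR, so `𝔭 ∩ R = (v)` by Matsumura 14.2;
`p ≡ p(θ) (mod X − θ)`). [cite: Matsumura1987, Thm. 14.2] -/
theorem exists_isRsopPart_span_eq_of_frame {n : ℕ} (hd : ringKrullDim R = (n + 1 : ℕ))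
    {h : R[X]} (hmo : h.Monic) (hm : 0 < h.natDegree)
    (hco : ∀ i < h.natDegree, h.coeff i ∈ maximalIdeal R ^ (h.natDegree - i))
    {𝔭 : Ideal R[X]} [𝔭.IsPrime] (hh : h ∈ 𝔭) [IsDiscreteValuationRing (R[X] ⧸ 𝔭)] :
    ∃ θ ∈ maximalIdeal R, ∃ v : Fin n → R, Literature.AlgebraicGeometry.Resolution.IsRsopPart v ∧
      𝔭 = Ideal.span (insert (X - C θ) (Set.range fun i => C (v i))) := by
  classical
  have h𝔭 := le_frameOrigin_of_mem hmo hco (Ideal.IsPrime.ne_top inferInstance) hh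
  have hsurj := surjective_algebraMap_quotient_of_frame hmo hm hco hh h𝔭
  obtain ⟨θ, hθm, hθ⟩ := exists_X_sub_C_mem_of_frame hmo hm hco hh
  set 𝔮 : Ideal R := RingHom.ker (algebraMap R (R[X] ⧸ 𝔭)) with h𝔮def
  have h𝔮eq : 𝔮 = 𝔭.comap C := by
    rw [h𝔮def, show algebraMap R (R[X] ⧸ 𝔭) = (Ideal.Quotient.mk 𝔭).comp C from RingHom.ext fun _ => rfl,
      ← RingHom.comap_ker, Ideal.mk_ker]
  let e : R ⧸ 𝔮 ≃+* R[X] ⧸ 𝔭 := RingHom.quotientKerEquivOfSurjective hsurj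
  haveI : 𝔮.IsPrime := RingHom.ker_isPrime _
  haveI : Nontrivial (R ⧸ 𝔮) := Ideal.Quotient.nontrivial_iff.mpr (Ideal.IsPrime.ne_top inferInstance)
  haveI : IsLocalRing (R ⧸ 𝔮) := IsLocalRing.of_surjective' (Ideal.Quotient.mk 𝔮) Ideal.Quotient.mk_surjective
  haveI : IsPrincipalIdealRing (R ⧸ 𝔮) := IsPrincipalIdealRing.of_surjective e.symm.toRingHom e.symm.surjective
  haveI : IsRegularLocalRing (R ⧸ 𝔮) := inferInstance
  have hdim𝔮 : ringKrullDim (R ⧸ 𝔮) = 1 := by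
    rw [ringKrullDim_eq_of_ringEquiv e]
    exact IsDiscreteValuationRing.ringKrullDim_eq_one _
  have h𝔮le : 𝔮 ≤ maximalIdeal R := IsLocalRing.le_maximalIdeal (Ideal.IsPrime.ne_top inferInstance)
  obtain ⟨v, hv, hvspan⟩ :=
    Literature.AlgebraicGeometry.Resolution.exists_isRsopPart_fin_span_range_eq (r := n) h𝔮le (by
      rw [hdim𝔮, hd]; push_cast; ring)
  refine ⟨θ, hθm, v, hv, le_antisymm ?_ ?_⟩
  · -- `𝔭 ≤ (X − θ, v)`: `p = (p − p(θ)) + p(θ)` with `p(θ) ∈ 𝔭 ∩ R = 𝔮 = (v)`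
    intro p hp
    have hdiv : p - C (p.eval θ) ∈ Ideal.span (insert (X - C θ) (Set.range fun i => C (v i))) :=
      Ideal.mem_span_insert.mpr ⟨(p - C (p.eval θ)) /ₘ (X - C θ), 0, Submodule.zero_mem _, by
        rw [add_zero, mul_comm]
        exact (Polynomial.mul_divByMonic_eq_iff_isRoot.mpr (by simp)).symm⟩
    have hev : C (p.eval θ) ∈ Ideal.span (insert (X - C θ) (Set.range fun i => C (v i))) := by
      have h1 : C (p.eval θ) ∈ 𝔭 := by
        have : C (p.eval θ) = p - (p - C (p.eval θ)) := by ring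
        rw [this]
        refine Ideal.sub_mem _ hp ?_
        exact Ideal.mem_span_singleton.mpr (Polynomial.X_sub_C_dvd_sub_C_eval) |> fun h' =>
          (Ideal.span_singleton_le_iff_mem _).mpr hθ h'
      have h2 : p.eval θ ∈ Ideal.span (Set.range v) := by
        rw [hvspan, h𝔮eq, Ideal.mem_comap]
        exact h1
      have h3 : C (p.eval θ) ∈ (Ideal.span (Set.range v)).map (C : R →+* R[X]) := Ideal.mem_map_of_mem _ h2
      rw [Ideal.map_span, ← Set.range_comp] at h3
      exact Ideal.span_mono (Set.subset_insert _ _) h3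
    have : p = (p - C (p.eval θ)) + C (p.eval θ) := by ring
    rw [this]
    exact Ideal.add_mem _ hdiv hev
  · rw [Ideal.span_le]
    rintro q hq
    rcases Set.mem_insert_iff.mp hq with rfl | ⟨i, rfl⟩
    · exact hθ
    · change C (v i) ∈ 𝔭
      have : v i ∈ 𝔮 := hvspan ▸ Ideal.subset_span ⟨i, rfl⟩
      rw [h𝔮eq, Ideal.mem_comap] at this
      exact this


/-- The DVR property transports along a ring isomorphism (principal ideal ring and locality by surjectivity, «not a field» by the
inverse). [folklore] -/
theorem isDiscreteValuationRing_of_ringEquiv {A B : Type*} [CommRing A] [IsDomain A] [CommRing B] [IsDomain B]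
    [IsDiscreteValuationRing A] (e : A ≃+* B) : IsDiscreteValuationRing B := by
  haveI : IsPrincipalIdealRing B := IsPrincipalIdealRing.of_surjective e.toRingHom e.surjective
  haveI : IsLocalRing B := IsLocalRing.of_surjective' e.toRingHom e.surjective
  have hnf : maximalIdeal B ≠ ⊥ := fun hB =>
    IsDiscreteValuationRing.not_isField A
      (MulEquiv.isField (IsLocalRing.isField_iff_maximalIdeal_eq.mpr hB) e.toMulEquiv)
  exact { not_a_field' := hnf }

/-- [OURS · L1 W4.2] **The same on the CP-frame carrier `R[X] ⧸ (h)`** (ring of res-type-067's `IsCPFrame`/`IsCPFrameAlong`): a prime `𝔓`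
of `R[X]/(h)` with DVR quotient is the image of `(X − θ, v₁, …, v_n) ⊆ R[X]`, `θ ∈ 𝔪`, `v` part of a regular system of parameters — the
shape `Ideal.map (Ideal.Quotient.mk (Ideal.span {h})) (Ideal.span {…})` of `IsCPFrameAlong` up to `X ↦ X − θ` and `u ↦ (u₀', v)`
(via `R[X]/comap 𝔓 ≅ (R[X]/(h))/𝔓`). [cite: Matsumura1987, Thm. 14.2] -/
theorem exists_isRsopPart_map_span_eq_of_frame {n : ℕ} (hd : ringKrullDim R = (n + 1 : ℕ))
    {h : R[X]} (hmo : h.Monic) (hm : 0 < h.natDegree)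
    (hco : ∀ i < h.natDegree, h.coeff i ∈ maximalIdeal R ^ (h.natDegree - i))
    {𝔓 : Ideal (R[X] ⧸ Ideal.span {h})} [𝔓.IsPrime] [IsDiscreteValuationRing ((R[X] ⧸ Ideal.span {h}) ⧸ 𝔓)] :
    ∃ θ ∈ maximalIdeal R, ∃ v : Fin n → R, Literature.AlgebraicGeometry.Resolution.IsRsopPart v ∧
      𝔓 = Ideal.map (Ideal.Quotient.mk (Ideal.span {h})) (Ideal.span (insert (X - C θ) (Set.range fun i => C (v i)))) := by
  classical
  set 𝔭 : Ideal R[X] := 𝔓.comap (Ideal.Quotient.mk (Ideal.span {h})) with h𝔭def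
  haveI : 𝔭.IsPrime := Ideal.comap_isPrime _ _
  have hI𝔭 : Ideal.span {h} ≤ 𝔭 := fun q hq => by
    rw [h𝔭def, Ideal.mem_comap, Ideal.Quotient.eq_zero_iff_mem.mpr hq]
    exact Submodule.zero_mem _
  have hh : h ∈ 𝔭 := hI𝔭 (Ideal.mem_span_singleton_self h)
  have h𝔓eq : 𝔓 = 𝔭.map (Ideal.Quotient.mk (Ideal.span {h})) :=
    (Ideal.map_comap_of_surjective _ Ideal.Quotient.mk_surjective 𝔓).symm
  let e : ((R[X] ⧸ Ideal.span {h}) ⧸ 𝔓) ≃+* R[X] ⧸ 𝔭 :=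
    (Ideal.quotEquivOfEq h𝔓eq).trans (DoubleQuot.quotQuotEquivQuotOfLE hI𝔭)
  haveI : IsDiscreteValuationRing (R[X] ⧸ 𝔭) :=
    isDiscreteValuationRing_of_ringEquiv (A := (R[X] ⧸ Ideal.span {h}) ⧸ 𝔓) (B := R[X] ⧸ 𝔭) e
  obtain ⟨θ, hθ, v, hv, h𝔭eq⟩ := exists_isRsopPart_span_eq_of_frame hd hmo hm hco hh
  exact ⟨θ, hθ, v, hv, by rw [h𝔓eq, ← h𝔭eq]⟩

end Regular

end Summit.ResolutionOfSingularities.ResolutionOfSingularities.Theorems.SigmaMaxModificationsCorridor3.Helpers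

end
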